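import Mathlib
import Summits.ValiantsHypothesis.ValiantsHypothesis.Theses.ValuativeGCT
import Literature.Computability.AlgebraicComplexity.BIPPaddingDegenerations
import Literature.Computability.AlgebraicComplexity.MultiplicityObstructionsProofs
import Literature.NumberTheory.DiophantineGeometry.SchurWeylPlethysmRenameProofs
import Summits.ValiantsHypothesis.ValiantsHypothesis.Theorems.DetqpThesis.Negative.NotQPBoundedOfExp
import Summits.ValiantsHypothesis.ValiantsHypothesis.Theorems.ValuativeGCTNoValuativeFlipBoundedLength
import Summits.ValiantsHypothesis.ValiantsHypothesis.Theorems.ValuativeGCTValuativeBound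

/-!
# The tail child is the whole crux (crux `ValuativeGCT.ValuativeFlip`, stmt-ValiantsHypothesis-12624;
# wall-breaker axis "representation-stability transfer between `m` and `m + 1`", k16 gen 1)

The route (rev 4) splits the crux `ValuativeFlip` (a valuative flip at EVERY position
`n ≤ m ≤ 2^((log₂ n + c)^c)` of every quasi-polynomial window) into a linear HEAD `HeadFlip` (flips at
`n ≤ m ≤ (a/b)·n` for SOME slope `a/b > 1`, attacked by the line `four-row-count`) and a TAIL `TailFlip`
(flips above EVERY slope, `(a/b)·n < m ≤ 2^((log₂ n + c)^c)`), glued by `HeadFlip → TailFlip → ValuativeFlip`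
and the two converses.  This file transfers flips between window POSITIONS and shows that the split is
degenerate as a decomposition:

* `valuativeFlip_of_tailFlip` — **`TailFlip → ValuativeFlip`**: the tail child alone is equivalent to the
  parent (`tailFlip_iff_valuativeFlip`), and in particular implies the head child
  (`headFlip_of_tailFlip : TailFlip → HeadFlip`).  Mechanism ("re-windowing", pure logic over the landed
  inner monotonicity `flipBody_mono_inner`, p115146): a shallow position `(n, m)`, `m ≤ 2n`, of the window
  with exponent `c` is reached from the STEEP position `(n'', m)`, `n'' = ⌊(m-1)/2⌋ < m/2`, which lies in the
  slope-2 tail of the window with exponent `c + 2` (`m ≤ 2n'' + 2 ≤ 2^((log₂ n'' + c + 2)^(c+2))`); the flip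
  there propagates up in the inner size to `(n, m)` because the padded permanent `X₀₀^{m-n''} per_{n''}` is a
  degeneration of `X₀₀^{m-n} per_n` and the determinant side does not see `n`.
* `valuativeFlip_iff_polyPadded` — for every `k ≥ 1` the crux is equivalent to its restriction to the
  POLYNOMIALLY PADDED positions `n^k ≤ m ≤ 2^((log₂ n + c)^c)` (window exponent trade `c ↦ c + k + 1`,
  steep inner size `n'' = max {t : t^k ≤ m}`).  So no initial segment of the window — the bottom `m = n`
  (landed), the linear head, or any polynomial padding `m ≤ n^k` — carries logical weight for the crux:
  closing `HeadFlip` proves the first multiplicity obstructions above the bottom but does not reduce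
  `ValuativeFlip`, whose whole content sits at super-polynomial padding (where bounded numbers of rows and
  bounded shape lengths are already excluded: `ValuativeGCTNoValuativeFlipBoundedLength`, four-row count
  stops at `m < √2·n`).

For the planner (D-0014): `ValuativeFlip ⇔ TailFlip`; the honest two-layer picture is
`{ValuativeFlip = TailFlip}` with `HeadFlip` a provable COROLLARY-grade item, not a conjunct; the glue item
`ValuativeFlipSplit` and the converse `ValuativeFlipToHead` are instances of this file's theorems.

Sources: this crux's `Cruxes/ValuativeFlip/STRATEGY-CENSUS.md` (the split) and `…/AxisK12SizeTransfer.md`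
(steep-edge normal form); Bürgisser–Ikenmeyer–Panova, J. AMS 32 (2019) §1(a) (inner degeneration of
paddings); Mulmuley–Sohoni, SIAM J. Comput. 31 (2001) §4–5; Bläser–Ikenmeyer 2025 §12.4.
-/

set_option linter.dupNamespace false

namespace Summit.ValiantsHypothesis.ValiantsHypothesis.Theorems.ValuativeFlip

open scoped BigOperators Matrix
open Literature.NumberTheory.DiophantineGeometry
open Literature.Computability.AlgebraicComplexity
open Summit.ValiantsHypothesis.ValiantsHypothesis.Theses.ValuativeGCT
open MvPolynomial
open Summit.ValiantsHypothesis.Theorems.DetqpThesis.Negative (qpBound_mono)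

/-! ## Inner monotonicity (private copy of the landed `orbitMultiplicity_paddedPer_mono_inner`,
`ValuativeGCTValuativeFlipInnerMonotone`, p115146 — copied to keep this file's imports inside the built library) -/

/-- One inner step: `X₀₀^{m-n} per_n ∈ Δ_m(X₀₀^{m-n-1} per_{n+1})` (BIP's corner degeneration, transported to the
lexicographic variables). [Bürgisser–Ikenmeyer–Panova 2019 §1(a)] -/
private theorem ts_paddedPerFormLex_mem_orbitClosure_succ {n m : ℕ} [NeZero m] (h : n + 1 ≤ m) :
    paddedPerFormLex ℂ n m ∈ orbitClosure (paddedPerFormLex ℂ (n + 1) m) := by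
  have h1 : paddedPerPoly ℂ n m ∈ orbitClosure (paddedPerPoly ℂ (n + 1) m) :=
    orbitClosure_bipPaddedPerPoly_subset (n + 1) m
      (paddedPerPoly_mem_orbitClosure_bipPaddedPerPoly_succ h)
  exact (rename_mem_orbitClosure_rename_iff_holds toLex (paddedPerPoly ℂ (n + 1) m)
    (paddedPerPoly ℂ n m)).2 h1

/-- Inner degeneration `X₀₀^{m-n} per_n ∈ Δ_m(X₀₀^{m-n'} per_{n'})` for `n ≤ n' ≤ m` (iterate; orbit closures are
transitive). [Bürgisser–Ikenmeyer–Panova 2019 §1(a)] -/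
private theorem ts_paddedPerFormLex_mem_orbitClosure_of_le {n n' m : ℕ} [NeZero m] (hnn' : n ≤ n') (hn'm : n' ≤ m) :
    paddedPerFormLex ℂ n m ∈ orbitClosure (paddedPerFormLex ℂ n' m) := by
  obtain ⟨d, rfl⟩ := Nat.exists_eq_add_of_le hnn'
  induction d with
  | zero => simpa using mem_orbitClosure_self (paddedPerFormLex ℂ n m)
  | succ d ih =>
    have hd : n + d ≤ m := by omega
    have hstep : paddedPerFormLex ℂ (n + d) m ∈ orbitClosure (paddedPerFormLex ℂ (n + d + 1) m) :=
      ts_paddedPerFormLex_mem_orbitClosure_succ (by omega)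
    exact orbitClosure_subset_of_mem_holds hstep (ih (Nat.le_add_right n d) hd)

/-- Inner monotonicity of padded-permanent multiplicities: `mult_χ ℂ[Δ_m(X₀₀^{m-n} per_n)] ≤
mult_χ ℂ[Δ_m(X₀₀^{m-n'} per_{n'})]` for `n ≤ n' ≤ m` (multiplicity-obstruction principle on the degeneration).
[Bläser–Ikenmeyer 2025 §12.4; Bürgisser–Ikenmeyer–Panova 2019 §1(a)] -/
private theorem ts_orbitMultiplicity_paddedPer_mono_inner {n n' m : ℕ} [NeZero m] (hnn' : n ≤ n') (hn'm : n' ≤ m)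
    (χ : Weight (MatIdx m)) :
    orbitMultiplicity ℂ (paddedPerFormLex ℂ n m) m χ ≤ orbitMultiplicity ℂ (paddedPerFormLex ℂ n' m) m χ :=
  orbitMultiplicity_le_of_mem_orbitClosure_holds (paddedPerFormLex ℂ n' m) (paddedPerFormLex ℂ n m)
    (NeZero.ne m) (paddedPerFormLex_isHomogeneous ℂ hn'm) (paddedPerFormLex_isHomogeneous ℂ (hnn'.trans hn'm))
    (ts_paddedPerFormLex_mem_orbitClosure_of_le hnn' hn'm) χ

/-! ## Window arithmetic -/

/-- Room in the window two exponents up: `2n'' + 2 ≤ W_{c+2}(n'')` — a matrix size `m ≤ 2n'' + 2` lies in the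
window of inner size `n''` with exponent `c + 2`. [folklore] -/
theorem two_mul_add_two_le_window (c n : ℕ) :
    2 * n + 2 ≤ 2 ^ ((Nat.log 2 n + (c + 2)) ^ (c + 2)) := by
  have h1 : n < 2 ^ (Nat.log 2 n + 1) := Nat.lt_pow_succ_log_self (by norm_num) n
  have h2 : 2 * n + 2 ≤ 2 ^ (Nat.log 2 n + 2) := by
    rw [pow_succ]
    omega
  refine h2.trans (Nat.pow_le_pow_right (by norm_num) ?_)
  calc Nat.log 2 n + 2 ≤ Nat.log 2 n + (c + 2) := by omega
    _ = (Nat.log 2 n + (c + 2)) ^ 1 := (pow_one _).symm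
    _ ≤ (Nat.log 2 n + (c + 2)) ^ (c + 2) := Nat.pow_le_pow_right (by omega) (by omega)

/-- Room in the window `k + 1` exponents up: `(n'' + 1)^k ≤ W_{c+k+1}(n'')` — a matrix size `m < (n''+1)^k`
lies in the window of inner size `n''` with exponent `c + k + 1`. [folklore] -/
theorem succ_pow_le_window (k c n : ℕ) :
    (n + 1) ^ k ≤ 2 ^ ((Nat.log 2 n + (c + k + 1)) ^ (c + k + 1)) := by
  rcases Nat.eq_zero_or_pos k with rfl | hk
  · rw [pow_zero]
    exact Nat.one_le_two_pow
  have h1 : n + 1 ≤ 2 ^ (Nat.log 2 n + 1) := Nat.lt_pow_succ_log_self (by norm_num) n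
  have h2 : (n + 1) ^ k ≤ 2 ^ (k * (Nat.log 2 n + 1)) := by
    rw [pow_mul']
    exact Nat.pow_le_pow_left h1 k
  refine h2.trans (Nat.pow_le_pow_right (by norm_num) ?_)
  set B := Nat.log 2 n + (c + k + 1) with hB
  calc k * (Nat.log 2 n + 1) ≤ B * B := Nat.mul_le_mul (by omega) (by omega)
    _ = B ^ 2 := (sq B).symm
    _ ≤ B ^ (c + k + 1) := Nat.pow_le_pow_right (by omega) (by omega)

/-! ## The tail child implies the parent -/

/-- **`TailFlip → ValuativeFlip`: the tail child of the split is the whole crux.**  Given `c`, use the tail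
at slope `2` with exponent `c + 2`: a position `(n, m)` with `2n < m` is a tail position outright (the window
bound is monotone in the exponent, `qpBound_mono`); a position with `m ≤ 2n` is reached from the tail position
`(⌊(m-1)/2⌋, m)` of the larger window (`two_mul_add_two_le_window`) by inner monotonicity of the flip body
(`flipBody_mono_inner`: the valuative truncation does not depend on `n`, and
`mult ℂ[Δ_m(X₀₀^{m-n''} per_{n''})] ≤ mult ℂ[Δ_m(X₀₀^{m-n} per_n)]` for `n'' ≤ n ≤ m`).
[this file; BIP 2019 §1(a)] -/
theorem valuativeFlip_of_tailFlip (hT : TailFlip) : ValuativeFlip := by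
  intro c
  obtain ⟨n₁, hn₁⟩ := hT 2 1 (by norm_num) (c + 2)
  refine ⟨2 * n₁ + 3, fun n hn m _ hnm hm => ?_⟩
  by_cases hcase : 2 * n < 1 * m
  · exact hn₁ n (by omega) m hcase (hm.trans (qpBound_mono (by omega) n))
  · have h1 : 2 * ((m - 1) / 2) < 1 * m := by omega
    have h2 : n₁ ≤ (m - 1) / 2 := by omega
    have h3 : (m - 1) / 2 ≤ n := by omega
    have h4 : m ≤ 2 ^ ((Nat.log 2 ((m - 1) / 2) + (c + 2)) ^ (c + 2)) :=
      le_trans (by omega) (two_mul_add_two_le_window c ((m - 1) / 2))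
    obtain ⟨U, r, δ, lam, hU, hcard, hlt⟩ := hn₁ ((m - 1) / 2) h2 m h1 h4
    exact ⟨U, r, δ, lam, hU, hcard,
      lt_of_lt_of_le hlt (ts_orbitMultiplicity_paddedPer_mono_inner h3 hnm _)⟩

/-- **`TailFlip ↔ ValuativeFlip`.**  The converse is the restriction of the crux to the tail (`a·n < b·m`
with `b < a` forces `n ≤ m`; = the route's glue item `ValuativeFlipToTail`). [this file] -/
theorem tailFlip_iff_valuativeFlip : TailFlip ↔ ValuativeFlip := by
  refine ⟨valuativeFlip_of_tailFlip, fun hV a b hba c => ?_⟩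
  obtain ⟨n₀, hn₀⟩ := hV c
  refine ⟨n₀, fun n hn m _ hnm hm => hn₀ n hn m ?_ hm⟩
  by_contra hlt
  have hmn : m ≤ n := by omega
  have : b * m ≤ a * n := (Nat.mul_le_mul_right m hba.le).trans (Nat.mul_le_mul_left a hmn)
  omega

/-- **`TailFlip → HeadFlip`: the head child is implied by the tail child** (through the parent, at slope
`2` and exponent `2`: `m ≤ 2n < 2^(log₂ n + 2) ≤ 2^((log₂ n + 2)^2)`).  So `HeadFlip ∧ TailFlip ⇔ TailFlip`:
the conjunct attacked by the line `four-row-count` is logically idle in the split (it remains the first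
provable multiplicity obstruction above the bottom of the window). [this file] -/
theorem headFlip_of_tailFlip (hT : TailFlip) : HeadFlip := by
  have hV := valuativeFlip_of_tailFlip hT
  obtain ⟨n₀, hn₀⟩ := hV 2
  refine ⟨2, 1, by norm_num, n₀, fun n hn m _ hnm hmn => hn₀ n hn m hnm ?_⟩
  have h1 : n < 2 ^ (Nat.log 2 n + 1) := Nat.lt_pow_succ_log_self (by norm_num) n
  have h2 : 1 * m ≤ 2 ^ (Nat.log 2 n + 2) := by
    rw [pow_succ]
    omega
  calc m = 1 * m := (one_mul m).symm
    _ ≤ 2 ^ (Nat.log 2 n + 2) := h2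
    _ ≤ 2 ^ ((Nat.log 2 n + 2) ^ 2) := Nat.pow_le_pow_right (by norm_num) (by nlinarith)

/-! ## Only polynomially padded positions matter -/

/-- **The crux is equivalent to its restriction to the positions `n^k ≤ m`** of the window, for every
fixed `k ≥ 1` (`k = 1` is the crux itself).  Forward: `n ≤ n^k`.  Backward: given `c`, use the restricted
statement with exponent `c + k + 1`; a position `(n, m)` with `m < n^k` is reached from the steep position
`(n'', m)`, `n'' = max {t ≤ m : t^k ≤ m}` (`Nat.findGreatest`), which satisfies `n''^k ≤ m < (n''+1)^k ≤
2^((log₂ n'' + c + k + 1)^(c+k+1))` (`succ_pow_le_window`) and `n'' < n`, by inner monotonicity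
(`flipBody_mono_inner`).  Hence the whole logical content of `ValuativeFlip` sits at super-polynomial
padding. [this file] -/
theorem valuativeFlip_iff_polyPadded (k : ℕ) (hk : 1 ≤ k) :
    ValuativeFlip ↔ ∀ c : ℕ, ∃ n₀ : ℕ, ∀ n ≥ n₀, ∀ (m : ℕ) [NeZero m], n ^ k ≤ m → m ≤ 2 ^ ((Nat.log 2 n + c) ^ c) →
    ∃ (U : Submodule ℂ (MatIdx m → ℂ)) (r δ : ℕ) (lam : Nat.Partition (m * δ)),
          (∀ u ∈ U, (Matrix.of fun a b : Fin m => u (toLex (a, b))).rank ≤ r) ∧ lam.parts.card ≤ m * m ∧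
            Module.finrank ℂ ↥(MvPolynomial.homogeneousSubmodule (MatIdx m × MatIdx m) ℂ (m * δ) ⊓
                ((MvPolynomial.vanishingIdeal ℂ
                    {p : MatIdx m × MatIdx m → ℂ | ∀ j : MatIdx m, (fun i => p (j, i)) ∈ U}) ^ (δ * (m - r))).restrictScalars ℂ ⊓
                (⨅ (M : Matrix (MatIdx m) (MatIdx m) ℂ)
                  (_ : linSubst (MatIdx m) ℂ M (detFormLex ℂ m) = detFormLex ℂ m),
                  LinearMap.ker ((MvPolynomial.aeval fun p : MatIdx m × MatIdx m =>
                      ∑ l : MatIdx m, M l p.2 •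
                        (MvPolynomial.X (p.1, l) : MvPolynomial (MatIdx m × MatIdx m) ℂ)).toLinearMap -
                    (LinearMap.id : MvPolynomial (MatIdx m × MatIdx m) ℂ →ₗ[ℂ] MvPolynomial (MatIdx m × MatIdx m) ℂ))) ⊓
                (⨅ (g : Matrix.GeneralLinearGroup (MatIdx m) ℂ) (_ : IsUpperTriangular g),
                  LinearMap.ker ((MvPolynomial.aeval fun p : MatIdx m × MatIdx m =>
                      ∑ l : MatIdx m, ((g⁻¹ : Matrix.GeneralLinearGroup (MatIdx m) ℂ) :
                        Matrix (MatIdx m) (MatIdx m) ℂ) p.1 l •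
                          (MvPolynomial.X (l, p.2) : MvPolynomial (MatIdx m × MatIdx m) ℂ)).toLinearMap -
                    weightChar ((Weight.dualOfPartition (m * m) lam).toMatIdx : Weight (MatIdx m)) g •
                      (LinearMap.id : MvPolynomial (MatIdx m × MatIdx m) ℂ →ₗ[ℂ] MvPolynomial (MatIdx m × MatIdx m) ℂ)))) <
              orbitMultiplicity ℂ (paddedPerFormLex ℂ n m) m
                ((Weight.dualOfPartition (m * m) lam).toMatIdx : Weight (MatIdx m)) := by
  constructor
  · intro hV c
    obtain ⟨n₀, hn₀⟩ := hV c
    refine ⟨n₀, fun n hn m _ hnk hm => hn₀ n hn m ?_ hm⟩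
    rcases Nat.eq_zero_or_pos n with h0 | hpos
    · omega
    · exact le_trans (by simpa using Nat.pow_le_pow_right hpos hk) hnk
  · intro H c
    obtain ⟨n₁, hn₁⟩ := H (c + k + 1)
    refine ⟨(n₁ + 1) ^ k + 1, fun n hn m _ hnm hm => ?_⟩
    have hk0 : k ≠ 0 := by omega
    have hn₁le : n₁ + 1 ≤ (n₁ + 1) ^ k := le_self_pow (by omega) hk0
    by_cases hcase : n ^ k ≤ m
    · exact hn₁ n (by omega) m hcase (hm.trans (qpBound_mono (by omega) n))
    · rw [not_le] at hcase
      -- the steep inner size `n'' = max {t ≤ m : t ^ k ≤ m}`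
      set n'' := Nat.findGreatest (fun t => t ^ k ≤ m) m with hn''
      have hP0 : (0 : ℕ) ^ k ≤ m := by rw [zero_pow hk0]; exact Nat.zero_le m
      have hspec : n'' ^ k ≤ m := Nat.findGreatest_spec (P := fun t => t ^ k ≤ m) (Nat.zero_le m) hP0
      have hle_m : n'' ≤ m := Nat.findGreatest_le m
      have hsucc : m < (n'' + 1) ^ k := by
        rcases eq_or_lt_of_le hle_m with heq | hlt
        · calc m < m + 1 := Nat.lt_succ_self m
            _ ≤ (m + 1) ^ k := le_self_pow (by omega) hk0
            _ = (n'' + 1) ^ k := by rw [heq]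
        · by_contra hge
          rw [not_lt] at hge
          exact Nat.findGreatest_is_greatest (P := fun t => t ^ k ≤ m) (Nat.lt_succ_self n'') (by omega) hge
      -- `n'' < n` since `n''^k ≤ m < n^k`
      have hn''n : n'' ≤ n := by
        have : n'' ^ k < n ^ k := lt_of_le_of_lt hspec hcase
        exact ((Nat.pow_lt_pow_iff_left hk0).mp this).le
      -- `n₁ ≤ n''` since `(n₁+1)^k ≤ n ≤ m < (n''+1)^k`
      have hn₁n'' : n₁ ≤ n'' := by
        have : (n₁ + 1) ^ k < (n'' + 1) ^ k := by omega
        have := (Nat.pow_lt_pow_iff_left hk0).mp this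
        omega
      have hwin : m ≤ 2 ^ ((Nat.log 2 n'' + (c + k + 1)) ^ (c + k + 1)) :=
        hsucc.le.trans (succ_pow_le_window k c n'')
      obtain ⟨U, r, δ, lam, hU, hcard, hlt⟩ := hn₁ n'' hn₁n'' m hspec hwin
      exact ⟨U, r, δ, lam, hU, hcard,
        lt_of_lt_of_le hlt (ts_orbitMultiplicity_paddedPer_mono_inner hn''n hnm _)⟩

/-! ## Appendix (k16 gen 1, same session): flip witnesses must have unboundedly many rows -/

/-- **The crux is equivalent to flips on shapes with MORE THAN `k` rows, for every fixed `k`.**  At the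
positions `n^(k+2) ≤ m ≤ 2^((log₂ n + c)^c)` — which carry the whole crux by
`valuativeFlip_iff_polyPadded` — a flip witness `(U, r, δ, λ)` cannot have `ℓ(λ) ≤ k`: for
`m ≥ n^(k+2) ≥ 1 + n(n+1)^k` (`n ≥ 2^k + 1`) shapes with at most `k` rows carry no valuative flip at all
(`NoValuativeFlip.noValuativeFlip_body_of_card_parts`: `mult_pp(λ*) ≤ K_m(λ*) ≤ dim T_U(λ)` by
inheritance/Valiant universality and the proved `ValuativeBound`).  So `ValuativeFlip` holds iff for
every `c`, eventually in `n`, every position `n^(k+2) ≤ m ≤ 2^((log₂ n + c)^c)` has a flip witness with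
`k < ℓ(λ)` — the length of flip witnesses is unbounded along the crux, and (with the Kadish–Landsberg
ceiling `ℓ(λ) ≤ m² + 1`) every line for the crux is a per-side engine on shapes of growing length at
super-polynomial padding. [this file; BLMW 2011 §5.3; `ValuativeGCTNoValuativeFlipBoundedLength`] -/
theorem valuativeFlip_iff_longShapes (k : ℕ) :
    ValuativeFlip ↔ ∀ c : ℕ, ∃ n₀ : ℕ, ∀ n ≥ n₀, ∀ (m : ℕ) [NeZero m], n ^ (k + 2) ≤ m → m ≤ 2 ^ ((Nat.log 2 n + c) ^ c) →
    ∃ (U : Submodule ℂ (MatIdx m → ℂ)) (r δ : ℕ) (lam : Nat.Partition (m * δ)),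
          (∀ u ∈ U, (Matrix.of fun a b : Fin m => u (toLex (a, b))).rank ≤ r) ∧ lam.parts.card ≤ m * m ∧ k < lam.parts.card ∧
            Module.finrank ℂ ↥(MvPolynomial.homogeneousSubmodule (MatIdx m × MatIdx m) ℂ (m * δ) ⊓
                ((MvPolynomial.vanishingIdeal ℂ
                    {p : MatIdx m × MatIdx m → ℂ | ∀ j : MatIdx m, (fun i => p (j, i)) ∈ U}) ^ (δ * (m - r))).restrictScalars ℂ ⊓
                (⨅ (M : Matrix (MatIdx m) (MatIdx m) ℂ)
                  (_ : linSubst (MatIdx m) ℂ M (detFormLex ℂ m) = detFormLex ℂ m),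
                  LinearMap.ker ((MvPolynomial.aeval fun p : MatIdx m × MatIdx m =>
                      ∑ l : MatIdx m, M l p.2 •
                        (MvPolynomial.X (p.1, l) : MvPolynomial (MatIdx m × MatIdx m) ℂ)).toLinearMap -
                    (LinearMap.id : MvPolynomial (MatIdx m × MatIdx m) ℂ →ₗ[ℂ] MvPolynomial (MatIdx m × MatIdx m) ℂ))) ⊓
                (⨅ (g : Matrix.GeneralLinearGroup (MatIdx m) ℂ) (_ : IsUpperTriangular g),
                  LinearMap.ker ((MvPolynomial.aeval fun p : MatIdx m × MatIdx m =>
                      ∑ l : MatIdx m, ((g⁻¹ : Matrix.GeneralLinearGroup (MatIdx m) ℂ) :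
                        Matrix (MatIdx m) (MatIdx m) ℂ) p.1 l •
                          (MvPolynomial.X (l, p.2) : MvPolynomial (MatIdx m × MatIdx m) ℂ)).toLinearMap -
                    weightChar ((Weight.dualOfPartition (m * m) lam).toMatIdx : Weight (MatIdx m)) g •
                      (LinearMap.id : MvPolynomial (MatIdx m × MatIdx m) ℂ →ₗ[ℂ] MvPolynomial (MatIdx m × MatIdx m) ℂ)))) <
              orbitMultiplicity ℂ (paddedPerFormLex ℂ n m) m
                ((Weight.dualOfPartition (m * m) lam).toMatIdx : Weight (MatIdx m)) := by
  constructor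
  · intro hV c
    obtain ⟨n₀, hn₀⟩ := (valuativeFlip_iff_polyPadded (k + 2) (by omega)).mp hV c
    refine ⟨max n₀ (2 ^ k + 1), fun n hn m _ hnk hm => ?_⟩
    obtain ⟨U, r, δ, lam, hU, hcard, hlt⟩ := hn₀ n (le_of_max_le_left hn) m hnk hm
    refine ⟨U, r, δ, lam, hU, hcard, ?_, hlt⟩
    -- a witness with at most `k` rows would contradict the bounded-length no-go
    by_contra hle
    rw [not_lt] at hle
    have hbound : 1 + n * (n + 1) ^ lam.parts.card ≤ m := by
      refine le_trans ?_ ((NoValuativeFlip.one_add_mul_succ_pow_le_pow (le_of_max_le_right hn)).trans hnk)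
      exact Nat.add_le_add_left (Nat.mul_le_mul_left n (Nat.pow_le_pow_right (by omega) hle)) 1
    have hge := NoValuativeFlip.noValuativeFlip_body_of_card_parts ValuativeBound.ValuativeBound_proof
      m U r hU δ lam hcard hbound
    exact absurd hlt (not_lt.mpr hge)
  · intro H
    refine (valuativeFlip_iff_polyPadded (k + 2) (by omega)).mpr fun c => ?_
    obtain ⟨n₀, hn₀⟩ := H c
    refine ⟨n₀, fun n hn m _ hnk hm => ?_⟩
    obtain ⟨U, r, δ, lam, hU, hcard, -, hlt⟩ := hn₀ n hn m hnk hm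
    exact ⟨U, r, δ, lam, hU, hcard, hlt⟩

end Summit.ValiantsHypothesis.ValiantsHypothesis.Theorems.ValuativeFlip
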